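/-
M16d (decomp-mm-lens-5 g29) — `CorrectedForwardModeAD` HOLDS: the plumbing statement of
`GraphEquationsCorrectedResidual` is a theorem (forward-mode AD plus one subtraction gate per test
gate).  After this file the only open leaf of hand 1, rung `K = 2`, is the residual
`HiddenTwistedCorrDeflation K₀` in the window `β' ≤ ω`.  No sorry.
-/
import Mathlib
import Summits.MatrixMultiplication.Statement
import Summits.MatrixMultiplication.MatrixMultiplication.Theorems.GraphEquationsCorrectedResidual

/-!
# Graph equations — forward-mode AD with correction gates

Supporting kernels for the crux `MultiplicityReduction` of route `GraphEquations`
(line `purisplit`, stub `BoundedOrderPurification`, rung `K = 2`).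

* `corrSystem E E_μ jμ iρ` — the differentiated system `AD(E, E_μ)` of `GraphEquationsForwardAD`
  followed by ONE SUBTRACTION GATE per gate `j < cost E` of `E`, computing
  `D_μ t_j − (value of the correction operand)`, where the correction operand reads test `iρ j` of
  `E_μ` (or the constant `0`); tests = the tests of `E` and the corrected derivatives.
  `corrSystem_cost`: `cost = 5·cost E + cost E_μ`; `corrSystem_isFanInTwo`;
  `corrSystem_testPoly_corr`: the subtraction gate of test gate `j` holds `D_μ t_j − rhoVal j`.
* `correctedForwardModeAD : CorrectedForwardModeAD` — **the plumbing statement HOLDS.**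
* `boundedOrderPurification_two_of_corrResidual` — hence rung `2` of BOP′ follows from the windowed
  corrected residual ALONE: `(∀ 2 ≤ β < β' ≤ ω, HiddenTwistedCorrDeflation K₀ β β') ⟹ BOP′(2)`
  (under `S` this is `nec_boundedOrderPurification_two` of `GraphEquationsFlatDeflation`).

NODE (hand 1, rung `K = 2`):  BOP′(2) ⟸ [`ω < β'`: TREE] ∧ [test-isolated: TREE] ∧
[const-deflatable: PROVED] ∧ [row-split: PROVED] ∧ [plumbing: PROVED, this file] ∧
[`HiddenTwistedCorrDeflation K₀`, `β' ≤ ω`: RESIDUAL — UNDECIDED · NEC · SUFF · WEAKEST typing so far].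
-/

-- dupNamespace: forced by the nested Summit.MatrixMultiplication.MatrixMultiplication layout (D-0017)
set_option linter.dupNamespace false

noncomputable section

open scoped BigOperators

namespace Summit.MatrixMultiplication.MatrixMultiplication.Theorems.GraphEquations

open MvPolynomial Literature.Computability.AlgebraicComplexity
open Literature.Computability.AlgebraicComplexity.ArithCircuit

variable {n : ℕ}

/-! ## The corrected differentiated system -/

/-- The correction operand of test gate `j`: test `i` of `E_μ` (read off the `E_μ` block of the
differentiated program, which starts at `L = cost E`) if `iρ j = some i` with `i < L_μ = cost E_μ`,
else the constant `0`. -/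
def rhoOp (L Lμ : ℕ) (iρ : ℕ → Option ℕ) (j : ℕ) : Operand ℂ (GraphVars n) :=
  match iρ j with
  | some i => if i < Lμ then .gate (L + i) else .const 0
  | none => .const 0

/-- The value the correction operand of test gate `j` is meant to read. -/
def rhoVal (Eμ : EqSystem n) (iρ : ℕ → Option ℕ) (j : ℕ) : MvPolynomial (GraphVars n) ℂ :=
  match iρ j with
  | some i => Eμ.testPoly i
  | none => 0

/-- The subtraction gate of test gate `j`: `1·(D_μ t_j) + (−1)·(correction)`; the derivative of
test gate `j` sits at `L + L_μ + 3j + 2` in `AD(E, E_μ)`. -/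
def corrGate (L Lμ : ℕ) (iρ : ℕ → Option ℕ) (j : ℕ) : Gate ℂ (GraphVars n) :=
  .sum [(1, .gate (L + Lμ + 3 * j + 2)), (-1, rhoOp L Lμ iρ j)]

/-- **THE CORRECTED DIFFERENTIATED SYSTEM**: `AD(E, E_μ)`, then one subtraction gate per gate of
`E`; tests = the tests of `E` (junk indices to the junk index `5·cost E + cost E_μ`) and the
corrected derivatives. -/
def corrSystem (E Eμ : EqSystem n) (jμ : Fin n × Fin n → ℕ) (iρ : ℕ → Option ℕ) : EqSystem n where
  circuit :=
    { gates := (adSystem E Eμ jμ).circuit.gates ++ (List.range E.cost).map (corrGate E.cost Eμ.cost iρ)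
      output := .const 0 }
  tests := E.tests.map (fun j => if j < E.cost then j else 5 * E.cost + Eμ.cost) ++
    E.tests.map (fun j => if j < E.cost then 4 * E.cost + Eμ.cost + j else 5 * E.cost + Eμ.cost)

section CorrSystem

variable (E Eμ : EqSystem n) (jμ : Fin n × Fin n → ℕ) (iρ : ℕ → Option ℕ)
  (μ : Fin n × Fin n → MvPolynomial (MatMulVars n) ℂ)

/-- The program of `AD(E, E_μ)` has `4·cost E + cost E_μ` gates. -/
theorem adSystem_gates_length : (adSystem E Eμ jμ).circuit.gates.length = 4 * E.cost + Eμ.cost :=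
  adSystem_cost E Eμ jμ

/-- The `E_μ` block of `AD(E, E_μ)`: test `i < cost E_μ` of `E_μ` sits at `cost E + i`. -/
theorem adSystem_testPoly_mu {i : ℕ} (hi : i < Eμ.cost) :
    (adSystem E Eμ jμ).testPoly (E.cost + i) = Eμ.testPoly i := by
  have hL := trimJunk_gates_length E
  have hi' : i < Eμ.circuit.gates.length := hi
  have happ : gateValues (E.circuit.trimJunk.gates ++ Eμ.circuit.gates.map (Gate.shift E.cost)) =
      gateValues E.circuit.gates ++ gateValues Eμ.circuit.gates := by
    rw [← hL, gateValues_append_shift, gateValues_trimJunk]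
  have h1 : (gateValues E.circuit.gates).length ≤ E.cost + i := by
    rw [gateValues_length]; exact Nat.le_add_right _ _
  have h2 : E.cost + i - (gateValues E.circuit.gates).length = i := by
    rw [gateValues_length]
    show E.cost + i - E.cost = i
    exact Nat.add_sub_cancel_left _ _
  simp only [EqSystem.testPoly, adSystem]
  rw [EqSystem.getD_gateValues_append (by rw [List.length_append, List.length_map, hL]; exact Nat.add_lt_add_left hi' _),
    happ, List.getD_eq_getElem?_getD, List.getD_eq_getElem?_getD, List.getElem?_append_right h1, h2]

/-- `cost (corrSystem) = 5·cost E + cost E_μ`. -/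
theorem corrSystem_cost : (corrSystem E Eμ jμ iρ).cost = 5 * E.cost + Eμ.cost := by
  show ((adSystem E Eμ jμ).circuit.gates ++ (List.range E.cost).map (corrGate E.cost Eμ.cost iρ)).length = _
  rw [List.length_append, List.length_map, List.length_range, adSystem_gates_length]
  ring

/-- `corrSystem` has fan-in two. -/
theorem corrSystem_isFanInTwo (hE : E.circuit.IsFanInTwo) (hEμ : Eμ.circuit.IsFanInTwo) :
    (corrSystem E Eμ jμ iρ).circuit.IsFanInTwo := by
  intro g hg
  simp only [corrSystem, List.mem_append, List.mem_map, List.mem_range] at hg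
  rcases hg with hg | ⟨j, -, rfl⟩
  · exact adSystem_isFanInTwo E Eμ jμ hE hEμ g hg
  · simp [corrGate, Gate.fanIn, Gate.args]

/-- The gates of `AD(E, E_μ)` keep their values: `j < 4·cost E + cost E_μ`. -/
theorem corrSystem_testPoly_of_lt {j : ℕ} (hj : j < 4 * E.cost + Eμ.cost) :
    (corrSystem E Eμ jμ iρ).testPoly j = (adSystem E Eμ jμ).testPoly j := by
  simp only [EqSystem.testPoly, corrSystem]
  exact EqSystem.getD_gateValues_append (by rw [adSystem_gates_length]; exact hj)

/-- The junk index of `corrSystem`. -/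
theorem corrSystem_testPoly_junk : (corrSystem E Eμ jμ iρ).testPoly (5 * E.cost + Eμ.cost) = 0 :=
  EqSystem.testPoly_eq_zero_of_le (corrSystem_cost E Eμ jμ iρ).le

/-- **The subtraction gate of test gate `j < cost E` holds `D_μ t_j − rhoVal j`.** -/
theorem corrSystem_testPoly_corr (hE : E.circuit.IsFanInTwo)
    (hjμ : ∀ q, Eμ.testPoly (jμ q) = liftAB n (μ q)) {j : ℕ} (hj : j < E.cost) :
    (corrSystem E Eμ jμ iρ).testPoly (4 * E.cost + Eμ.cost + j) =
      derivC μ (E.testPoly j) - rhoVal Eμ iρ j := by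
  have hG := adSystem_gates_length E Eμ jμ
  simp only [EqSystem.testPoly, corrSystem]
  set G := (adSystem E Eμ jμ).circuit.gates with hGdef
  set N := (List.range E.cost).map (corrGate (n := n) E.cost Eμ.cost iρ) with hNdef
  have hN : N.length = E.cost := by simp [hNdef]
  have hm : 4 * E.cost + Eμ.cost + j < (G ++ N).length := by rw [List.length_append, hG, hN]; omega
  rw [getD_gateValues_eq_eval_take _ hm]
  have hget : (G ++ N)[4 * E.cost + Eμ.cost + j] = corrGate E.cost Eμ.cost iρ j := by
    rw [List.getElem_append_right (by omega)]
    simp [hNdef, hG]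
  have htake : (G ++ N).take (4 * E.cost + Eμ.cost + j) = G ++ N.take j := by
    rw [← hG, List.take_length_add_append]
  rw [hget, htake]
  obtain ⟨t, ht⟩ := EqSystem.gateValues_prefix G (N.take j)
  rw [ht]
  have hval : ∀ d < 4 * E.cost + Eμ.cost,
      (Operand.gate d : Operand ℂ (GraphVars n)).eval (gateValues G ++ t) = (adSystem E Eμ jμ).testPoly d :=
    fun d hd => by
      rw [Operand.eval_gate, EqSystem.testPoly, List.getD_eq_getElem?_getD, List.getD_eq_getElem?_getD,
        List.getElem?_append_left (by rw [gateValues_length, hG]; exact hd)]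
  have hd : (Operand.gate (E.cost + Eμ.cost + 3 * j + 2) : Operand ℂ (GraphVars n)).eval (gateValues G ++ t) =
      derivC μ (E.testPoly j) := by
    rw [hval _ (by omega), adSystem_testPoly_deriv E Eμ jμ μ hE hjμ hj]
  have hρ : (rhoOp E.cost Eμ.cost iρ j : Operand ℂ (GraphVars n)).eval (gateValues G ++ t) = rhoVal Eμ iρ j := by
    unfold rhoOp rhoVal
    cases iρ j with
    | none => exact C_0
    | some i =>
      simp only
      split_ifs with hi
      · rw [hval _ (by omega), adSystem_testPoly_mu E Eμ jμ hi]
      · rw [EqSystem.testPoly_eq_zero_of_le (not_lt.mp hi)]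
        exact C_0
  simp only [corrGate, Gate.eval, List.map_cons, List.map_nil, List.sum_cons, List.sum_nil, hd, hρ, one_smul,
    neg_smul, add_zero]
  exact (sub_eq_add_neg _ _).symm

end CorrSystem

/-- **`CorrectedForwardModeAD` HOLDS.** -/
theorem correctedForwardModeAD : CorrectedForwardModeAD := by
  intro n E Eμ μ ρ hE hEμ hμ hρ hρ0
  classical
  choose jμ _ hjμ using hμ
  -- the correction indices
  let iρ : ℕ → Option ℕ := fun j =>
    if h : ∃ i ∈ Eμ.tests, Eμ.testPoly i = liftAB n (ρ j) then some h.choose else none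
  have hval : ∀ j ∈ E.tests, rhoVal Eμ iρ j = liftAB n (ρ j) := fun j hj => by
    unfold rhoVal
    by_cases h : ∃ i ∈ Eμ.tests, Eμ.testPoly i = liftAB n (ρ j)
    · have hsome : iρ j = some h.choose := dif_pos h
      rw [hsome]
      exact h.choose_spec.2
    · have hnone : iρ j = none := dif_neg h
      rw [hnone, ((hρ j hj).resolve_right h), map_zero]
  have hold : ∀ j ∈ E.tests,
      (corrSystem E Eμ jμ iρ).testPoly (if j < E.cost then j else 5 * E.cost + Eμ.cost) = E.testPoly j :=
    fun j hj => by
      split_ifs with h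
      · rw [corrSystem_testPoly_of_lt E Eμ jμ iρ (by omega), adSystem_testPoly_of_lt E Eμ jμ h]
      · rw [corrSystem_testPoly_junk, EqSystem.testPoly_eq_zero_of_le (not_lt.mp h)]
  have hnew : ∀ j ∈ E.tests,
      (corrSystem E Eμ jμ iρ).testPoly (if j < E.cost then 4 * E.cost + Eμ.cost + j else 5 * E.cost + Eμ.cost) =
        derivC μ (E.testPoly j) - liftAB n (ρ j) := fun j hj => by
    split_ifs with h
    · rw [corrSystem_testPoly_corr E Eμ jμ iρ μ hE hjμ h, hval j hj]
    · have h0 : E.testPoly j = 0 := EqSystem.testPoly_eq_zero_of_le (not_lt.mp h)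
      rw [corrSystem_testPoly_junk, h0, hρ0 j hj h0, derivC_zero, map_zero, sub_zero]
  refine ⟨corrSystem E Eμ jμ iρ, corrSystem_isFanInTwo E Eμ jμ iρ hE hEμ, ⟨fun j hj => ?_, fun j hj => ?_⟩,
    fun j' hj' => ?_, (corrSystem_cost E Eμ jμ iρ).le⟩
  · exact ⟨_, List.mem_append_left _ (List.mem_map.mpr ⟨j, hj, rfl⟩), hold j hj⟩
  · exact Or.inr ⟨_, List.mem_append_right _ (List.mem_map.mpr ⟨j, hj, rfl⟩), hnew j hj⟩
  · simp only [corrSystem, List.mem_append, List.mem_map] at hj'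
    rcases hj' with ⟨j, hj, rfl⟩ | ⟨j, hj, rfl⟩
    · exact Or.inl ⟨j, hj, hold j hj⟩
    · exact Or.inr ⟨j, hj, hnew j hj⟩

/-! ## Rung `K = 2` of BOP′ from the corrected residual alone -/

/-- **Rung `2` of BOP′ from the windowed corrected residual ALONE.** -/
theorem boundedOrderPurification_two_of_corrResidual (K₀ : ℕ)
    (hR : ∀ β β' : ℝ, 2 ≤ β → β < β' → β' ≤ omega ℂ → HiddenTwistedCorrDeflation K₀ β β')
    (β : ℝ) (hβ : 2 ≤ β) (hiso : EqAdmissibleIdealIso β 2) (β' : ℝ) (hββ' : β < β') :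
    EqAdmissiblePure β' :=
  boundedOrderPurification_two_of_corrected K₀ correctedForwardModeAD hR β hβ hiso β' hββ'

/-- The same from the unwindowed corrected residual. -/
theorem boundedOrderPurification_two_of_corrResidual' (K₀ : ℕ)
    (hR : ∀ β β' : ℝ, 2 ≤ β → β < β' → HiddenTwistedCorrDeflation K₀ β β')
    (β : ℝ) (hβ : 2 ≤ β) (hiso : EqAdmissibleIdealIso β 2) (β' : ℝ) (hββ' : β < β') :
    EqAdmissiblePure β' :=
  boundedOrderPurification_two_of_corrected' K₀ correctedForwardModeAD hR β hβ hiso β' hββ'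

end Summit.MatrixMultiplication.MatrixMultiplication.Theorems.GraphEquations

end
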